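import Summits.AnomalousDissipation.AnomalousDissipation.Theses.TaylorCertificates
import Summits.AnomalousDissipation.AnomalousDissipation.Theorems.KolmogorovFloor.Negative.BelowTaylor

/-!
# Line `dressed-laminar-ray` — NEGATIVE skeleton for the crux `TaylorCertificates.KolmogorovFloor`
(stmt-AnomalousDissipation-14030, rank 2) — crux-plan seat, 2026-08-16

**This is NOT a concluding skeleton.** The idea `dressed-laminar-ray` (Ideas/dressed-laminar-ray.md, memo
DRESSED-RAY-r1-3.md, SketchIdeator3.lean; triage r1: 3/3 pass) is a NEGATIVE lever: its theorems conclude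
`¬ FloorClassAtFor β f` (β ≤ 3/4) for every trigonometric-polynomial force with a shear frame, and — with the
conjectural general-force step — `¬ KolmogorovFloor`. No composition of its lemmas concludes the route decl
`KolmogorovFloor`; the mechanical gate `#h21_check_skeleton` (a local theorem whose conclusion HEAD is the
crux constant) therefore cannot pass on this line without costume, and the seat reports `no-skeleton`.

What this file IS: the typed, `lean check`ed stub set of the negative line, in the shape the crux protocol
uses (`stub_*` sorried, compositions kernel-checked), handed to the standing disprover (`Disproof.lean`,
cdisprove) and to tenure:

* `RayFamily β f` — the frame-free KINEMATIC INTERFACE of the line (= Disproof (F4) regime II made formal):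
  for all constants, at arbitrarily small `ν`, a smooth solenoidal mean-zero trigonometric-polynomial state
  `a` of degree `≤ Λ`, deep inside the Leray ball, quiet (`(1+2Θ)ν‖∇a‖² + 2Θ|(a,f)| ≤ ε`), whose WHOLE
  generator `(f,W) + ν(a,ΔW) + I(a,W)` is `≤ den·M` against every band-limited solenoidal `W` of slope
  `|k|‖Ŵ(k)‖ ≤ M`, with `den ≤ ε` and `den × (beat price) = den·(1+2Θ)ν(Cν^{-β}+Λ+1)² ≤ ε`.
* `stub_endgame`     : `RayFamily β f → FloorKillAtFor β f` (memo §2 Steps 1–3: floor at `a` or the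
                        coords-invisible axis-carrier beat at `a + tw`; M — landed `Negative/AxisBeat*`,
                        `ThreeModesBase` generalised to a trig-poly base and a `|q|`-weighted gain).
* `stub_rayOfResponse`: Euler shear `U ⊥ f` + `ApproxLinearResponse f U` ⇒ `RayFamily β f`, `β ≤ 3/4`
                        (memo §2 bookkeeping (a1)–(a6): `a = ν^{-3/8}U + ν^{3/8}b_K`, `K = ⌈ν^{-7/10}⌉`; S–M).
* `stub_axisFrameResponse`: THEOREM B in AXIS frames (memo §3.2–3.4, triage-sharpened scope `OffCross f`):
                        inhomogeneous Rayleigh at `c = 0` per mode line, log critical layers, 2×2 cosh solve;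
                        M–L; the hardest PAPER-PROVED stub (modulo the written (R4)/(R5)).
* `stub_skewFrameResponse`: THEOREM B in fully skew frames for the remaining polynomial forces (memo §3.5 +
                        frame lemma; M, paper-sketched).
* `stub_smoothForceRay`: THEOREM C (memo §5): `RayFamily (3/4) f` for NON-polynomial smooth `f` via
                        `ν`-dependent frames; L, CONJECTURE-WITH-RECIPE — the hardest stub overall.
* Compositions (sorry-free): `floorClassAtFor_false_of_offCross` (stubs 1–3: the landable Negative lemma
  for the route's intended force class, Taylor–Green designer force included), `kolmogorovFloorPoly_false_of`
  (stubs 1–4), `kolmogorovFloor_false_of` (stubs 1–5: `¬ KolmogorovFloor` BY NAME).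
* Consistency with the landed Negative lemmas: `floorClassAtFor_false_of_lt_half` re-derives the per-force
  form of `Negative.BelowTaylor.not_floor_lt_half` (β < 1/2, unconditional); no stub asserts a floor, so no
  stub is an instance a landed Negative lemma refutes.

Disproof.lean (cdisprove cycle 1) honoured: (F5) every state here is a finite-enstrophy trig poly (nothing
uses the junk `D = 0`); (F1) `f = 0` is killed at rest inside `stub_endgame` (hence `RayFamily` carries the
premise `0 < ‖f‖₂²`); (F3) all `β ≤ 3/4` die together; (F4) `RayFamily` IS regime II's "unknown family"
(`𝔐₁ → 0`, `Λ_a ≪ N`); (F8) weights are decoration — `Θ` enters only through `(1+2Θ)`.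

Definitions `FloorClassAtFor`, `FloorKillAtFor`, `IsEulerShear`, `slopeSum`, `SlopeLE`,
`ApproxLinearResponse`, `KolmogorovFloorPoly` are copied from `Cruxes/KolmogorovFloor/SketchIdeator3.lean`
(ideator 3, rc 0) so that this file is self-contained.
-/

noncomputable section

set_option linter.dupNamespace false

open MeasureTheory UnitAddTorus
open scoped InnerProductSpace ENNReal BigOperators

namespace Summit.AnomalousDissipation.AnomalousDissipation.Cruxes.KolmogorovFloor.DressedLaminarRay

open Literature.Analysis.FunctionSpaces Literature.Analysis.FluidPDE
open Summit.AnomalousDissipation.AnomalousDissipation.Theses.TaylorCertificates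

local notation "𝕋³" => UnitAddTorus (Fin 3)
local notation "E³" => EuclideanSpace ℝ (Fin 3)
local notation "L2T" => Lp (EuclideanSpace ℝ (Fin 3)) 2 (volume : Measure (UnitAddTorus (Fin 3)))

/-! ## §A  The crux as a resolution class (from SketchIdeator3, logic PROVED) -/

/-- The band-limited FLOOR clause of resolution exponent `β` for ONE force `f`: verbatim the body of the
route decl `KolmogorovFloor` after its `∃ f, admissible ∧`, with `3/4 ↦ β`. -/
def FloorClassAtFor (β : ℝ) (f : 𝕋³ → E³) : Prop :=
  ∃ (ε₀ C Θ ν₀ : ℝ), 0 < ε₀ ∧ 0 < ν₀ ∧ ∀ ν : ℝ, 0 < ν → ν < ν₀ →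
    ∃ (N : ℕ) (Φ₁ : Torus.CylindricalTest (Fin 3)) (θ₁ : ℝ), (N : ℝ) ≤ C * ν ^ (-β) ∧
    (∀ i, Torus.fourierTruncate N (Φ₁.g i) = Φ₁.g i) ∧ -Θ ≤ θ₁ ∧ θ₁ ≤ 0 ∧
    ∀ u : Torus.energySpace (Fin 3),
      let uf : 𝕋³ → E³ := ((u : L2T) : 𝕋³ → E³);
      let D : ℝ := ν * (Torus.eGradNormSq uf).toReal;
      let P : ℝ := Torus.pairing (u : L2T) f - D;
      Torus.eGradNormSq uf ≠ ⊤ → ‖u‖ ^ 2 ≤ 16 * (∫ x, ‖f x‖ ^ 2) / ν ^ 2 →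
      ε₀ ≤ D + Torus.nsGeneratorPairing ν f u (Φ₁.grad u) + 2 * θ₁ * P

/-- The crux is the Kolmogorov class `β = 3/4` for SOME admissible force (definitional). -/
theorem kolmogorovFloor_iff :
    KolmogorovFloor ↔ ∃ f : 𝕋³ → E³, Torus.IsSmooth f ∧ Torus.IsDivFree f ∧ Torus.HasZeroMean f ∧
      FloorClassAtFor (3 / 4) f :=
  Iff.rfl

/-- **Kill shape** for the class `β` and the force `f` (the `∀∃` form of `¬ FloorClassAtFor β f`, in the
quantifier order of the crux: constants first, then a small `ν`, then — AFTER the certificate `(N, Φ₁, θ₁)`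
is revealed — a violating finite-enstrophy state of the Leray ball). -/
def FloorKillAtFor (β : ℝ) (f : 𝕋³ → E³) : Prop :=
  ∀ (ε₀ C Θ ν₀ : ℝ), 0 < ε₀ → 0 < ν₀ → ∃ ν : ℝ, 0 < ν ∧ ν < ν₀ ∧
    ∀ (N : ℕ) (Φ₁ : Torus.CylindricalTest (Fin 3)) (θ₁ : ℝ), (N : ℝ) ≤ C * ν ^ (-β) →
    (∀ i, Torus.fourierTruncate N (Φ₁.g i) = Φ₁.g i) → -Θ ≤ θ₁ → θ₁ ≤ 0 →
    ∃ u : Torus.energySpace (Fin 3),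
      let uf : 𝕋³ → E³ := ((u : L2T) : 𝕋³ → E³);
      let D : ℝ := ν * (Torus.eGradNormSq uf).toReal;
      let P : ℝ := Torus.pairing (u : L2T) f - D;
      Torus.eGradNormSq uf ≠ ⊤ ∧ ‖u‖ ^ 2 ≤ 16 * (∫ x, ‖f x‖ ^ 2) / ν ^ 2 ∧
      D + Torus.nsGeneratorPairing ν f u (Φ₁.grad u) + 2 * θ₁ * P < ε₀

/-- Glue (pure logic), per class and force. -/
theorem not_floorClassAtFor_of_kill {β : ℝ} {f : 𝕋³ → E³} (hK : FloorKillAtFor β f) :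
    ¬ FloorClassAtFor β f := by
  rintro ⟨ε₀, C, Θ, ν₀, hε₀, hν₀, h⟩
  obtain ⟨ν, hν, hνν₀, hkill⟩ := hK ε₀ C Θ ν₀ hε₀ hν₀
  obtain ⟨N, Φ₁, θ₁, hN, hΦ₁, hθ₁, hθ₁', hu⟩ := h ν hν hνν₀
  obtain ⟨u, hfin, hball, hlt⟩ := hkill N Φ₁ θ₁ hN hΦ₁ hθ₁ hθ₁'
  exact absurd (hu u hfin hball) (not_le.mpr hlt)

/-- Glue (pure logic): a Kolmogorov-class kill for every admissible force refutes the crux BY NAME. -/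
theorem not_kolmogorovFloor_of_kill
    (hK : ∀ f : 𝕋³ → E³, Torus.IsSmooth f → Torus.IsDivFree f → Torus.HasZeroMean f →
      FloorKillAtFor (3 / 4) f) : ¬ KolmogorovFloor := by
  rintro ⟨f, hfs, hfd, hfz, hfloor⟩
  exact not_floorClassAtFor_of_kill (hK f hfs hfd hfz) hfloor

/-- The crux restricted to TRIGONOMETRIC-POLYNOMIAL forces (every force the route can "pin": header,
NOT DECOMPOSED YET — "ONE explicit genuinely three-dimensional trigonometric-polynomial force"). -/
def KolmogorovFloorPoly : Prop :=
  ∃ f : 𝕋³ → E³, Torus.IsSmooth f ∧ Torus.IsDivFree f ∧ Torus.HasZeroMean f ∧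
    (∃ d : ℕ, Torus.fourierTruncate d f = f) ∧ FloorClassAtFor (3 / 4) f

-- (Ideator 3's `kolmogorovFloor_of_poly : KolmogorovFloorPoly → KolmogorovFloor` is deliberately NOT
-- copied: a theorem concluding the crux from an unregistered sub-class hypothesis is exactly the COSTUME the
-- skeleton gate flags (`skeleton.extra-hypothesis`); this line has no positive content to offer the gate.)

/-- Consistency with the LANDED negative lemmas (`Theorems/KolmogorovFloor/Negative/BelowTaylor.lean`,
cdisprove, sorry-free): every class `β < 1/2` is already dead for every admissible force, unconditionally.
(The line below extends this to `β ≤ 3/4`, conditionally on its stubs.) -/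
theorem floorClassAtFor_false_of_lt_half {β : ℝ} (hβ : β < 1 / 2) {f : 𝕋³ → E³}
    (hfs : Torus.IsSmooth f) (hfd : Torus.IsDivFree f) (hfz : Torus.HasZeroMean f) :
    ¬ FloorClassAtFor β f := fun h =>
  Summit.AnomalousDissipation.AnomalousDissipation.Theorems.KolmogorovFloor.Negative.not_floor_lt_half hβ
    ⟨f, hfs, hfd, hfz, h⟩

/-! ## §B  Objects of the line (from SketchIdeator3) -/

/-- A smooth STEADY EULER SHEAR skeleton: a divergence-free, mean-zero trigonometric polynomial `U` with
vanishing self-advection `(U·∇)U = 0` pointwise — e.g. `U = sin(2π ξ·x) ê` with lattice vectors `ξ ⊥ e`.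
Exact zero of the Euler nonlinearity, viscous drift LINEAR in the amplitude: the cone the ray climbs. -/
structure IsEulerShear (U : 𝕋³ → E³) : Prop where
  smooth : Torus.IsSmooth U
  divFree : Torus.IsDivFree U
  zeroMean : Torus.HasZeroMean U
  trigPoly : ∃ d : ℕ, Torus.fourierTruncate d U = U
  selfAdvection : ∀ x, Torus.convect U U x = 0

/-- The weighted `ℓ¹` slope `K_w(D) := Σ_{|k| ≤ D} |k| ‖ŵ(k)‖` of a field (prices the viscous pairing
`ν|(∇a, ∇W)| ≤ 4π² ν K_a · max_k |k|‖Ŵ(k)‖`). -/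
def slopeSum (D : ℕ) (w : 𝕋³ → E³) : ℝ :=
  ∑ k ∈ Torus.freqBall D, Real.sqrt (Torus.freqNormSq k) * ‖mFourierCoeff (EuclideanSpace.complexify ∘ w) k‖

/-- `M` bounds the resolved slope of `W`: `|k| ‖Ŵ(k)‖ ≤ M` for every frequency — the BEAT-DUAL
normalisation (the coords-invisible beat at mode `q` gains `∝ |q|‖Ŵ(q)‖` per unit energy, because the
inertial term differentiates `W`). Note `SlopeLE W M → 0 ≤ M` (take `k = 0`). -/
def SlopeLE (W : 𝕋³ → E³) (M : ℝ) : Prop :=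
  ∀ k : Fin 3 → ℤ, Real.sqrt (Torus.freqNormSq k) * ‖mFourierCoeff (EuclideanSpace.complexify ∘ W) k‖ ≤ M

/-- **FIRST-LEMMA object (ideator 3) — approximate linear response of the shear `U` to the force `f`.**
For every resolution `K ≥ 1` a solenoidal mean-zero trigonometric polynomial `b_K` of degree `≤ K` with
(R1) energy `≤ C_b`, (R2) slope `≤ C_b K`, (R3) enstrophy `≤ C_b K`, (R4) `|(L_U b_K − f, W)| ≤ (C_b/K)·M` and
(R5) `|((b_K·∇)b_K, W)| ≤ C_b(1 + log K)·M` for band-limited solenoidal `W` with `SlopeLE W M`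
(`L_U b = (U·∇)b + (b·∇)U`; gradients pair to zero with solenoidal `W`). Paper construction: memo §3
(inhomogeneous Rayleigh equation at `c = 0` per Fourier mode line; PV + two delta responses fixed by
`L²`-admissibility at the two critical layers; explicit two-term recurrences); numerics j009650/j009978
(defect in fact `≍ 17.9/K²`, self-advection `≍ 14.5 log K`), independently j010983 / TRIAGE-r1-1 App. B. -/
def ApproxLinearResponse (f U : 𝕋³ → E³) : Prop :=
  ∃ Cb : ℝ, ∀ K : ℕ, 1 ≤ K → ∃ b : 𝕋³ → E³,
    Torus.IsSmooth b ∧ Torus.IsDivFree b ∧ Torus.HasZeroMean b ∧ Torus.fourierTruncate K b = b ∧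
    (∫ x, ‖b x‖ ^ 2) ≤ Cb ∧ slopeSum K b ≤ Cb * K ∧ Torus.gradNormSq b ≤ Cb * K ∧
    ∀ (D : ℕ) (W : 𝕋³ → E³) (M : ℝ), Torus.IsSmooth W → Torus.IsDivFree W → Torus.HasZeroMean W →
      Torus.fourierTruncate D W = W → SlopeLE W M →
      |∫ x, ⟪Torus.convect U b x + Torus.convect b U x - f x, W x⟫_ℝ| ≤ Cb / K * M ∧
      |∫ x, ⟪Torus.convect b b x, W x⟫_ℝ| ≤ Cb * (1 + Real.log K) * M

/-- **Off one coordinate cross** (triage-sharpened scope of THEOREM B in axis frames, memo §3.4): for some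
axis `j`, every Fourier mode `k` of `f` has `Σ_{i ≠ j} kᵢ² ≥ 2`, i.e. no mode lies in the cross
`X_j = ℤe_j + {0, ±eᵢ, ±e_l}`. Holds for every force supported off the three coordinate crosses, for generic
two/three-shell forces, and for the Taylor–Green designer force (`supp f̂ ⊂ {|k|² = 8}`, `j = 2`). -/
def OffCross (f : 𝕋³ → E³) : Prop :=
  ∃ j : Fin 3, ∀ k : Fin 3 → ℤ, mFourierCoeff (EuclideanSpace.complexify ∘ f) k ≠ 0 →
    (2 : ℝ) ≤ Torus.freqNormSq k - ((k j : ℤ) : ℝ) ^ 2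

/-! ## §C  The kinematic interface of the line: dressed-ray families -/

/-- **RAY FAMILY of exponent `β` for the force `f`** — what the endgame consumes and what the dressed ray
supplies (memo §2 after the bookkeeping (a1)–(a6); = Disproof (F4) regime II "phantom family with
`𝔐₁ → 0`, `Λ_a ≪ N`", typed). If `f ≠ 0` then for all `C, Θ ≥ 0`, every tolerance `ε > 0` and every `ν₀ > 0`
there is `ν ∈ (0, min(ν₀,1))` and a smooth solenoidal mean-zero trigonometric polynomial `a` of degree `≤ Λ`
with: the modes of `f` above `Λ` uniformly `≤ τ` with `Θτ ≤ ε` (`τ = 0` for polynomial `f`); room in the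
Leray ball (`‖a‖² + 1 ≤ 16‖f‖²/ν²`); quiet and work-free up to `ε` (`(1+2Θ)ν‖∇a‖² + 2Θ|(a,f)| ≤ ε`); the
generator `(f,W) + ν(a,ΔW) + ∫⟪∇W·a, a⟫` bounded by `den·M` on every solenoidal `W` band-limited at any
admissible resolution `N ≤ Cν^{-β}` with `SlopeLE W M`; and `den ≤ ε`, `den·(1+2Θ)ν(Cν^{-β} + Λ + 1)² ≤ ε`
(defect × beat price). For the dressed ray `a = ν^{-3/8}U + ν^{3/8}b_K`: `den ≍ ν^{5/8}`, price `≍ C²ν^{-1/2}`. -/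
def RayFamily (β : ℝ) (f : 𝕋³ → E³) : Prop :=
  0 < (∫ x, ‖f x‖ ^ 2) →
  ∀ (C Θ ε ν₀ : ℝ), 0 ≤ C → 0 ≤ Θ → 0 < ε → 0 < ν₀ →
    ∃ ν : ℝ, 0 < ν ∧ ν < ν₀ ∧ ν < 1 ∧
    ∃ (Λ : ℕ) (a : 𝕋³ → E³) (den τ : ℝ),
      Torus.IsSmooth a ∧ Torus.IsDivFree a ∧ Torus.HasZeroMean a ∧ Torus.fourierTruncate Λ a = a ∧
      (∀ k : Fin 3 → ℤ, (Λ : ℝ) ^ 2 < Torus.freqNormSq k →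
        ‖mFourierCoeff (EuclideanSpace.complexify ∘ f) k‖ ≤ τ) ∧
      0 ≤ τ ∧ Θ * τ ≤ ε ∧ 0 ≤ den ∧ den ≤ ε ∧
      (∫ x, ‖a x‖ ^ 2) + 1 ≤ 16 * (∫ x, ‖f x‖ ^ 2) / ν ^ 2 ∧
      (1 + 2 * Θ) * (ν * Torus.gradNormSq a) + 2 * Θ * |∫ x, ⟪a x, f x⟫_ℝ| ≤ ε ∧
      den * ((1 + 2 * Θ) * ν * (C * ν ^ (-β) + (Λ : ℝ) + 1) ^ 2) ≤ ε ∧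
      ∀ (N : ℕ) (W : 𝕋³ → E³) (M : ℝ), (N : ℝ) ≤ C * ν ^ (-β) →
        Torus.IsSmooth W → Torus.IsDivFree W → Torus.HasZeroMean W → Torus.fourierTruncate N W = W →
        SlopeLE W M →
        |(∫ x, ⟪f x, W x⟫_ℝ) + ν * (∫ x, ⟪a x, Torus.laplacian W x⟫_ℝ) +
            ∫ x, ⟪Torus.fderiv W x (a x), a x⟫_ℝ| ≤ den * M

/-! ## §D  The five stubs (sorried: the disprover's targets, in landing order 1 → 2 → 3 → 4 → 5) -/

/-- STUB 1 statement — **the endgame** (memo §2 Steps 0–3, THEOREM A minus its bookkeeping): a ray family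
kills the floor class of the same exponent, in the crux's quantifier order. Proof on paper: `f = 0` dies at
rest (`u = 0`, FLOOR(0) = 0); else take `ε := c·ε₀` (absolute `c`), the `ν, a` of the family; reveal
`(N, Φ₁, θ₁)`, `W := Φ₁'(a)`, `M_W := max_k |k|‖Ŵ(k)‖`; FLOOR(a) ≤ ε + den·M_W, so either `u := a` violates,
or `den·M_W ≥ ε₀/2`, and the two-wave axis-carrier beat `w` at the maximising `q` (carriers `m eᵢ − q`, `m eᵢ`,
`m = 3N + 1 + 2Λ`: outside the band, `> N + Λ` from it, so `coords(a + tw) = coords(a)`, all base–wave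
pairings vanish by Fourier-support disjointness, `|(w,f)| ≤ 2√2 τ`) with `t² = 3den/c_g ≤ 1` gives
FLOOR(a + tw) ≤ ε + t²·price + 4√2Θτ − ε₀ < ε₀. Lean: landed `Negative/AxisBeat(Offset)`, `ThreeModesBase`,
`grad_eq_of_coords_eq`, `fc_grad_eq_zero`; NEW pieces = trig-poly base state of degree `Λ` (not a single mode)
and the `|q|`-weighted gain `≥ c_g α²|q|‖Ĝ(q)‖` (axis_beat_data records `(9/10)α²‖Ĝ(q)‖`). Size M. -/
def EndgameStatement : Prop :=
  ∀ (β : ℝ) (f : 𝕋³ → E³), Torus.IsSmooth f → Torus.IsDivFree f → Torus.HasZeroMean f →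
    RayFamily β f → FloorKillAtFor β f

/-- STUB 2 statement — **the dressed ray is a ray family** (memo §2 (a1)–(a6) + Step 0): for a polynomial
force, an Euler shear `U` with `(U,f) = 0` carrying an approximate linear response gives `RayFamily β f` for
every `β ≤ 3/4`, via `a := ν^{-3/8}U + ν^{3/8}b_K`, `K := ⌈ν^{-7/10}⌉`, `Λ := max(K, deg U, deg f)`, `τ := 0`,
`den := 4π²νK_a + C_b/K + ν^{3/4}C_b(1 + log K) ≤ C₁ν^{5/8}`; quietness `2G_Uν^{1/4} + 4C_bν^{1.05}`, work
`2Θν^{3/8}C_b^{1/2}‖f‖`, price `(1+2Θ)ν(Cν^{-β}+Λ+1)² ≲ (1+2Θ)(C²ν^{-1/2} + ν^{-0.4})`, so `den·price ≲ ν^{1/8} → 0`;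
the residual identity `(f,W) + I(a,W) = (f − (a·∇)a, W)`, `(a·∇)a = L_U b_K + ν^{3/4}(b_K·∇)b_K` (since
`(U·∇)U = 0`) turns (R4),(R5) into the generator bound. Size S–M (Parseval / `realTrigPoly` bookkeeping +
one integration by parts). -/
def RayOfResponseStatement : Prop :=
  ∀ (f U : 𝕋³ → E³), Torus.IsSmooth f → Torus.IsDivFree f → Torus.HasZeroMean f →
    (∃ d : ℕ, Torus.fourierTruncate d f = f) → IsEulerShear U → (∫ x, ⟪U x, f x⟫_ℝ) = 0 →
    ApproxLinearResponse f U → ∀ β : ℝ, β ≤ 3 / 4 → RayFamily β f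

/-- STUB 3 statement — **THEOREM B in axis frames** (memo §3.2–3.4; triage r1-1 App. B, r1-2 §N/(i′), r1-3 (X3)
re-derived the critical-layer algebra independently): a solenoidal mean-zero trigonometric-polynomial force OFF
ONE COORDINATE CROSS admits an Euler shear `U = sin(2πx_j)·e/|e|` (`e ⊥ e_j` a lattice direction with
`(kᵢ,k_l)·(p,r) ≠ 0 ≠ (kᵢ,k_l)·(r,−p)` on `supp f̂` — finitely many exclusions) with `(U,f) = 0` (no mode of `f`
at `±e_j`) carrying an approximate linear response: per mode line the Squire-reduced inhomogeneous Rayleigh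
equation `S(Y'' − μ̃²Y) = r`, `μ̃² = 4π²(kᵢ² + k_l² − 1) ≥ 4π²` (cosh regime), `Y = 𝒢[PV(r/S) + λ₀δ₀ + λ_½δ_½]`
with the two `L²`-admissibility conditions `Y(y_c) = β_c` solved by the invertible matrix
`[G(0) G(½); G(½) G(0)]` (`|G(½)|/G(0) = 1/cosh(μ̃/2) < 1`); `X ~ log|y − y_c|`, coefficients `|X̂(j)| ≍ 1/j`,
`|Ŷ(j)| ≍ 1/j²`; (R1)–(R3) immediate, (R4) `O(1/K)` (in fact `1/K²`), (R5) `O(log K)` — the two 1-D estimates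
not yet written. Phrase for `b_K` directly as explicit sequences (two-term recurrences). Size M–L. -/
def AxisFrameResponseStatement : Prop :=
  ∀ f : 𝕋³ → E³, Torus.IsSmooth f → Torus.IsDivFree f → Torus.HasZeroMean f →
    (∃ d : ℕ, Torus.fourierTruncate d f = f) → OffCross f →
    ∃ U : 𝕋³ → E³, IsEulerShear U ∧ (∫ x, ⟪U x, f x⟫_ℝ) = 0 ∧ ApproxLinearResponse f U

/-- STUB 4 statement — **THEOREM B in fully skew frames** (memo §3.5 + frame lemma §3.1, card K3): a
polynomial force meeting ALL THREE coordinate crosses still has a lattice shear frame `(ξ, e)`, `ξ ⊥ e`, with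
no mode of `f` on `e^⊥ ∪ n^⊥` (`n = ξ × e`; two finite families of planes), `|k_⊥| ≠ |ξ|` on `supp f̂`, and
non-resonant critical-layer matrices (cosh regime `|k_⊥| > |ξ|`: automatic for every phase; oscillatory
regime: the Diophantine coincidence `(j|ξ|² + s)² = |ξ|⁴ − |ξ|²|k|² + (k·ξ)²` excludes finitely many frames of
a one-parameter family `ξ_t`), carrying an approximate linear response by the same ODE in `θ = ξ·x` with
`d/dy ↦ |ξ|(∂_θ + iρ_ℓ)`. Paper-SKETCHED only (no triager re-derived §3.5); size M. -/
def SkewFrameResponseStatement : Prop :=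
  ∀ f : 𝕋³ → E³, Torus.IsSmooth f → Torus.IsDivFree f → Torus.HasZeroMean f →
    (∃ d : ℕ, Torus.fourierTruncate d f = f) → ¬ OffCross f →
    ∃ U : 𝕋³ → E³, IsEulerShear U ∧ (∫ x, ⟪U x, f x⟫_ℝ) = 0 ∧ ApproxLinearResponse f U

/-- STUB 5 statement — **THEOREM C, general smooth forces** (memo §5; CONJECTURE-WITH-RECIPE, the hardest
stub): a NON-polynomial smooth solenoidal mean-zero force still carries a Kolmogorov ray family, via
`ν`-DEPENDENT frames: `L := ν^{-σ'}`; `e = e(ν)`, `|e| ≲ L³`, with `k·e ≠ 0` for `0 < |k| ≤ L`; `ξ ⊥ e` primitive,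
`|ξ| ≲ poly(L)`, `det(ξ,e,k) ≠ 0`, `|k_⊥| ≠ |ξ|`, quantitatively non-resonant (integrality: a non-square
integer is `≥ 1` from every square ⇒ relative divisors `≥ poly(L)⁻¹`); the modes of `f` above `L` are
`O(L^{-∞}) = O(ν^{∞})` in Wiener norm and go into `den` and `τ`; the response of `P_L f` has constants
`poly(L) = ν^{-O(σ')}`, absorbed by the spare powers `ν^{1/8}`, `ν^{0.05}` of §2 after normalising the shear
amplitude by `|ξ|`. Why it might fail: every mode line is in the OSCILLATORY regime once `|ξ| ≫ L`, where the
layer-matrix determinant is trigonometric in `(ω_ℓ/|ξ|, ρ_ℓ)` — a uniform `poly(L)⁻¹` lower bound over all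
`O(L³)` lines of ONE frame is the unwritten small-divisor lemma. Size L. -/
def SmoothForceRayStatement : Prop :=
  ∀ f : 𝕋³ → E³, Torus.IsSmooth f → Torus.IsDivFree f → Torus.HasZeroMean f →
    (¬ ∃ d : ℕ, Torus.fourierTruncate d f = f) → RayFamily (3 / 4) f

/-- STUB 1 (M): the endgame — a ray family kills its floor class. -/
theorem stub_endgame : EndgameStatement := by
  sorry

/-- STUB 2 (S–M): the dressed ray `ν^{-3/8}U + ν^{3/8}b_K` of a shear-borne linear response is a ray family
for every `β ≤ 3/4`. -/
theorem stub_rayOfResponse : RayOfResponseStatement := by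
  sorry

/-- STUB 3 (M–L; hardest paper-proved stub): THEOREM B in axis frames, for forces off one coordinate cross. -/
theorem stub_axisFrameResponse : AxisFrameResponseStatement := by
  sorry

/-- STUB 4 (M; paper-sketched): THEOREM B in fully skew frames, for polynomial forces meeting every cross. -/
theorem stub_skewFrameResponse : SkewFrameResponseStatement := by
  sorry

/-- STUB 5 (L; conjecture-with-recipe; HARDEST): THEOREM C — ray families for non-polynomial smooth forces. -/
theorem stub_smoothForceRay : SmoothForceRayStatement := by
  sorry

/-! ## §E  Compositions (sorry-free logic over the stub statements) -/

/-- **Landable first (stubs 1–3): the Kolmogorov floor — and every class `β ≤ 3/4` — is false for every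
polynomial force off one coordinate cross** (the route header's intended witness class and the
Taylor–Green designer force). The `Negative/` lemma the disprover should aim at. -/
theorem floorClassAtFor_false_of_offCross (h1 : EndgameStatement) (h2 : RayOfResponseStatement)
    (h3 : AxisFrameResponseStatement) {β : ℝ} (hβ : β ≤ 3 / 4) {f : 𝕋³ → E³}
    (hfs : Torus.IsSmooth f) (hfd : Torus.IsDivFree f) (hfz : Torus.HasZeroMean f)
    (hpoly : ∃ d : ℕ, Torus.fourierTruncate d f = f) (hoc : OffCross f) : ¬ FloorClassAtFor β f := by
  obtain ⟨U, hU, hUf, hR⟩ := h3 f hfs hfd hfz hpoly hoc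
  exact not_floorClassAtFor_of_kill (h1 β f hfs hfd hfz (h2 f U hfs hfd hfz hpoly hU hUf hR β hβ))

/-- Stubs 1–4: every polynomial force carries a Kolmogorov ray family. -/
theorem rayFamily_of_poly (h2 : RayOfResponseStatement) (h3 : AxisFrameResponseStatement)
    (h4 : SkewFrameResponseStatement) {β : ℝ} (hβ : β ≤ 3 / 4) {f : 𝕋³ → E³}
    (hfs : Torus.IsSmooth f) (hfd : Torus.IsDivFree f) (hfz : Torus.HasZeroMean f)
    (hpoly : ∃ d : ℕ, Torus.fourierTruncate d f = f) : RayFamily β f := by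
  by_cases hoc : OffCross f
  · obtain ⟨U, hU, hUf, hR⟩ := h3 f hfs hfd hfz hpoly hoc
    exact h2 f U hfs hfd hfz hpoly hU hUf hR β hβ
  · obtain ⟨U, hU, hUf, hR⟩ := h4 f hfs hfd hfz hpoly hoc
    exact h2 f U hfs hfd hfz hpoly hU hUf hR β hβ

/-- **Stubs 1–4: the crux has no trigonometric-polynomial witness.** -/
theorem kolmogorovFloorPoly_false_of (h1 : EndgameStatement) (h2 : RayOfResponseStatement)
    (h3 : AxisFrameResponseStatement) (h4 : SkewFrameResponseStatement) : ¬ KolmogorovFloorPoly := by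
  rintro ⟨f, hfs, hfd, hfz, hpoly, hfloor⟩
  exact not_floorClassAtFor_of_kill (h1 _ f hfs hfd hfz (rayFamily_of_poly h2 h3 h4 le_rfl hfs hfd hfz hpoly))
    hfloor

/-- Stubs 2–5: EVERY admissible force carries a Kolmogorov ray family (the `DressedRayLaw` of ideator 3,
decomposed). -/
theorem rayFamily_all (h2 : RayOfResponseStatement) (h3 : AxisFrameResponseStatement)
    (h4 : SkewFrameResponseStatement) (h5 : SmoothForceRayStatement) (f : 𝕋³ → E³)
    (hfs : Torus.IsSmooth f) (hfd : Torus.IsDivFree f) (hfz : Torus.HasZeroMean f) :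
    RayFamily (3 / 4) f := by
  by_cases hpoly : ∃ d : ℕ, Torus.fourierTruncate d f = f
  · exact rayFamily_of_poly h2 h3 h4 le_rfl hfs hfd hfz hpoly
  · exact h5 f hfs hfd hfz hpoly

/-- **THE LINE'S CONCLUSION (stubs 1–5): `¬ KolmogorovFloor`, the route decl BY NAME, negated.**
This is why the seat answers `no-skeleton`: the line decides the crux NEGATIVELY; nothing here can be
turned into `… → KolmogorovFloor`. -/
theorem kolmogorovFloor_false_of (h1 : EndgameStatement) (h2 : RayOfResponseStatement)
    (h3 : AxisFrameResponseStatement) (h4 : SkewFrameResponseStatement) (h5 : SmoothForceRayStatement) :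
    ¬ KolmogorovFloor :=
  not_kolmogorovFloor_of_kill fun f hfs hfd hfz => h1 _ f hfs hfd hfz (rayFamily_all h2 h3 h4 h5 f hfs hfd hfz)

/-- The same conclusion from the five sorried stubs (so that `lean check` reports exactly which `sorry`s the
refutation of the crux still rests on: `stub_endgame`, `stub_rayOfResponse`, `stub_axisFrameResponse`,
`stub_skewFrameResponse`, `stub_smoothForceRay`). -/
theorem kolmogorovFloor_false : ¬ KolmogorovFloor :=
  kolmogorovFloor_false_of stub_endgame stub_rayOfResponse stub_axisFrameResponse stub_skewFrameResponse
    stub_smoothForceRay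

end Summit.AnomalousDissipation.AnomalousDissipation.Cruxes.KolmogorovFloor.DressedLaminarRay

end
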